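import Mathlib
import HarnessLib

/-!
# K6 crux `MuTransfer` (stmt-BirchSwinnertonDyer-19629), stub `stub_x9`: MU-TRANSFER-PROOF §3
# LEMMA 2 — the Kolyvagin class over `Ω = Λ/p` at an `E`-split prime, its DESCENT and its VALUES,
# kernel-checked at cochain level (induced-module model)

Cell `bsd-smallim`, seat `bsd-smallim-k6-c2` (D-0074 group (F)). HONEST FRAMING: theorems only (no
definition, no named fact, D-0026); pure algebra of maps `G → 𝒯` for an abstract group `G`; nothing
is asserted about any curve and nothing is booked. Fifth KERNEL file for the registered stub `stub_x9`
(Kato μ-transfer on class X9 = KOLY-MEMO Thm. 5.7.1 / Cor. 5.7.2).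

MU-TRANSFER-PROOF §3 ("COCHAINS", "DESCENT", "VALUES") works in the induced module
`𝕎 = Maps(G, 𝒯)`, `(g·w)(x) = w(xg)`, `ι(t)(x) = ρ(x)t`, where a class of `H¹(U, 𝒯)` is a `w ∈ 𝕎`
with `(u − 1)w ∈ ι𝒯` for `u ∈ U`, its cocycle being `c(u) = ι⁻¹((u−1)w)`, i.e. `w(xu) = w(x) + ρ(x)c(u)`.
INPUT of Lemma 2 (Kato, Astérisque 295, §13.3 (13.1.1) at `r = 1`, reduced mod `p`, NORMALISED as in
the memo): representatives `w_q` (a class of `H = G_K`, cocycle `c_q`), `w_1` (a class of `G`, cocycle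
`c_1`) with `𝒩w_q = P·w_1 + ι(t_N)`, `𝒩 = Σ_{j<n} σ^j`, `n = [G : H] = q − 1 ≡ 0`, `C(n,2) ≡ 0` in
`Ω`; Lemma 1 (i): the cocycles vanish on the inertia `ℐ` (`c_1|_ℐ = 0`, `c_q|_{ℐ∩H} = 0`), `ρ(ℐ) = 1`,
`σ ∈ ℐ`; the tame relation `σ^{-j}Frσ^{j} ∈ (ℐ ∩ H)·Fr`; (F5): `ρ(Fr) = g` a scalar with
`g − 1 = T^e·u₁`, `P = u_P·(g − 1)²`, and `g − 1` injective on `𝒯`. OUTPUT (the four sentences the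
proof of Theorem A consumes, Step 3): for the derivative `W = D·w_q = Σ_{j<n} j·σ^j·w_q`,
* `descent_H` — `(h − 1)W = ι(Σ_j j·c_q(σ^{-j}hσ^j))` for `h ∈ H` (so `W` restricted to `H` represents
  `D·𝐳̄_q`, and `κ̃` is a cocycle on `H` with values in `𝒯`);
* `descent_sigma` — `(σ − 1)W = −P·w_1 − ι(t_N)` (the `ℤ[G]`-identity `(σ−1)D = nσ^n − σ𝒩`, kernel
  p404514, applied to `w_q`; so `κ̃(σ) ≡ −t_N (mod T^{2e})` since `P ∈ T^{2e}Ω`);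
* `tN_eq` — **the key formula** `t_N = −u_P·(g−1)·c_1(Fr)` (`= −U'·T^e·t_1`), from (3.1) at `h = Fr`
  (`n·t_q = 0`);
* `value_Fr`, `value_inertia` — `κ̃(Fr) = C(n,2)·t_q = 0` and `κ̃(τ) = 0` for `τ ∈ ℐ ∩ H`
  (transversality at `q`).
* `cocycle_vanish_on_inertia` (appended) — Lemma 1 (i): a cocycle of the decomposition group at an
  `E`-split prime vanishes on the tame inertia ("`(φ̃ − q)c(τ) = (φ̃ − 1)c(τ) = 0`").
* `exists_normalised_repr` (appended) — the COCHAINS normalisation `𝒩w_q = P·w_1 + ι(t_N)` from the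
  norm relation modulo `ι𝒯 + 𝕎^G` (subtract the `H`-invariant coset function `m·𝟙_H`).
The remaining sentence of Lemma 2 ("`κ̃` is a `𝒯_J`-valued cocycle on all of `G = ⟨σ, H⟩`, unramified
outside `pNq`") is cohomological packaging of these identities (inflation–restriction, (F1)) and is
left to the typed interface.

References: HOME/koly/MU-TRANSFER-PROOF.md §3 (= KOLY-MEMO Lemma 5.6.2 / Prop. 5.5.A over `Ω`);
K. Kato, Astérisque 295 (2004) §13.3 [Kato2004Asterisque]; K. Rubin, *Euler Systems* (2000) §4.4
(the derivative construction); B. Mazur, K. Rubin, Mem. AMS 799 (2004) App. A.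
-/

-- the summit and its single problem are both named `BirchSwinnertonDyer` (registry layout D-0017)
set_option linter.dupNamespace false

set_option autoImplicit false

namespace Summit.BirchSwinnertonDyer.BirchSwinnertonDyer.Rank1Residual.KolyvaginClass

open Finset

variable {Ω : Type*} [CommRing Ω] {𝒯 : Type*} [AddCommGroup 𝒯] [Module Ω 𝒯]
  {G : Type*} [Group G] (ρ : G →* (𝒯 →ₗ[Ω] 𝒯))

/-! ### §1 Cocycles in the induced-module model -/

/-- In the induced module `𝕎 = Maps(G, 𝒯)`: `w` represents a class of `H¹(U, 𝒯)` with cocycle `c`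
iff `w(xu) = w(x) + ρ(x)·c(u)` for `u ∈ U`; then `c` satisfies the cocycle identity on `U`
(`c(uv) = c(u) + ρ(u)c(v)`) as soon as some `ρ(x)` is injective — here recorded for `x = 1`.
[folklore] -/
theorem cocycle_of_repr (U : Subgroup G) (w : G → 𝒯) (c : G → 𝒯)
    (hw : ∀ u ∈ U, ∀ x : G, w (x * u) = w x + ρ x (c u)) {u v : G} (hu : u ∈ U) (hv : v ∈ U) :
    c (u * v) = c u + ρ u (c v) := by
  have h1 := hw (u * v) (U.mul_mem hu hv) 1
  have h2 := hw v hv u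
  have h3 := hw u hu 1
  rw [one_mul, map_one, Module.End.one_apply] at h1 h3
  rw [h2, h3, add_assoc] at h1
  exact (add_left_cancel h1).symm

/-- A cocycle vanishing on an element `τ` acting trivially is insensitive to left translation by `τ`:
`c(τ·y) = c(y)`. [folklore] -/
theorem cocycle_mul_left_of_vanish (U : Subgroup G) (w : G → 𝒯) (c : G → 𝒯)
    (hw : ∀ u ∈ U, ∀ x : G, w (x * u) = w x + ρ x (c u)) {τ y : G} (hτ : τ ∈ U) (hy : y ∈ U)
    (hcτ : c τ = 0) (hρτ : ρ τ = 1) : c (τ * y) = c y := by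
  rw [cocycle_of_repr ρ U w c hw hτ hy, hcτ, hρτ, zero_add, Module.End.one_apply]

/-! ### §2 The derivative `W = D·w_q` and its descent -/

/-- Shifting a sum over `range n`: `Σ_{j<n} f(j+1) = Σ_{j<n} f(j) + f(n) − f(0)`. [folklore] -/
theorem sum_range_succ_shift {M : Type*} [AddCommGroup M] (f : ℕ → M) (n : ℕ) :
    ∑ j ∈ range n, f (j + 1) = (∑ j ∈ range n, f j) + f n - f 0 := by
  have h1 := sum_range_succ' f n
  have h2 := sum_range_succ f n
  rw [h2] at h1
  rw [eq_sub_iff_add_eq, ← h1]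

section Descent

variable (σ : G) (n : ℕ) (w_q : G → 𝒯)

/-- **DESCENT on `H` (MU-TRANSFER-PROOF §3): `(h − 1)W = ι(Σ_j j·c_q(σ^{-j}hσ^j))`.** For `h` in the
NORMAL subgroup `H` and `W(x) = Σ_{j<n} j·w_q(xσ^j)`: `W(xh) − W(x) = ρ(x)·Σ_{j<n} j·c_q(σ^{-j}hσ^j)`
(`ρ(σ) = 1`). [folklore] -/
theorem descent_H (H : Subgroup G) [H.Normal] (c_q : G → 𝒯)
    (hwq : ∀ h ∈ H, ∀ x : G, w_q (x * h) = w_q x + ρ x (c_q h)) (hρσ : ρ σ = 1)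
    {h : G} (hh : h ∈ H) (x : G) :
    (∑ j ∈ range n, (j : Ω) • w_q (x * h * σ ^ j)) - ∑ j ∈ range n, (j : Ω) • w_q (x * σ ^ j) =
      ρ x (∑ j ∈ range n, (j : Ω) • c_q ((σ ^ j)⁻¹ * h * σ ^ j)) := by
  rw [map_sum, ← sum_sub_distrib]
  refine sum_congr rfl fun j _ => ?_
  have hj : (σ ^ j)⁻¹ * h * σ ^ j ∈ H := by
    have := (inferInstance : H.Normal).conj_mem h hh (σ ^ j)⁻¹
    simpa using this
  have hρj : ρ (σ ^ j) = 1 := by rw [map_pow, hρσ, one_pow]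
  have hx : x * h * σ ^ j = x * σ ^ j * ((σ ^ j)⁻¹ * h * σ ^ j) := by group
  rw [hx, hwq _ hj, map_mul, hρj, mul_one, smul_add, add_sub_cancel_left, map_smul]

/-- **DESCENT at `σ` (MU-TRANSFER-PROOF §3): `(σ − 1)W = −P·w_1 − ι(t_N)`.** The `ℤ[G]`-identity
`(σ − 1)·D = n·σ^n − σ·𝒩` (`D = Σ jσ^j`, `𝒩 = Σ σ^j`) applied to `w_q`, with `n ≡ 0` in `Ω`,
`w_q(xσ^n) = w_q(x)` (`σ^n ∈ ℐ ∩ H`, `c_q(σ^n) = 0`) and the normalised norm relation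
`𝒩w_q = P·w_1 + ι(t_N)`. [folklore] -/
theorem descent_sigma (hn : (n : Ω) = 0) (w_1 : G → 𝒯) (P : Ω) (t_N : 𝒯)
    (hnorm : ∀ x : G, ∑ j ∈ range n, w_q (x * σ ^ j) = P • w_1 x + ρ x t_N)
    (hσn : ∀ x : G, w_q (x * σ ^ n) = w_q x) (x : G) :
    (∑ j ∈ range n, (j : Ω) • w_q (x * σ * σ ^ j)) - ∑ j ∈ range n, (j : Ω) • w_q (x * σ ^ j) =
      -(P • w_1 x + ρ x t_N) := by
  set f : ℕ → 𝒯 := fun m => w_q (x * σ ^ m) with hf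
  have hshift : ∀ j : ℕ, w_q (x * σ * σ ^ j) = f (j + 1) := by
    intro j
    simp only [hf, pow_succ', mul_assoc]
  have h1 : ∑ j ∈ range n, (j : Ω) • w_q (x * σ * σ ^ j) =
      (∑ j ∈ range n, ((j + 1 : ℕ) : Ω) • f (j + 1)) - ∑ j ∈ range n, f (j + 1) := by
    rw [← sum_sub_distrib]
    refine sum_congr rfl fun j _ => ?_
    rw [hshift, Nat.cast_succ, add_smul, one_smul, add_sub_cancel_right]
  have h2 : ∑ j ∈ range n, ((j + 1 : ℕ) : Ω) • f (j + 1) =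
      (∑ j ∈ range n, (j : Ω) • f j) + (n : Ω) • f n - (0 : Ω) • f 0 := by
    have := sum_range_succ_shift (fun m => (m : Ω) • f m) n
    simpa using this
  have h3 : ∑ j ∈ range n, f (j + 1) = (∑ j ∈ range n, f j) + f n - f 0 :=
    sum_range_succ_shift f n
  have hfn : f n = f 0 := by simp only [hf, pow_zero, mul_one]; exact hσn x
  have hN : ∑ j ∈ range n, f j = P • w_1 x + ρ x t_N := hnorm x
  rw [h1, h2, h3, hn, zero_smul, zero_smul, hfn, hN]
  simp only [hf]
  abel

end Descent

/-! ### §3 The key formula `t_N = −u_P·(g − 1)·c_1(Fr)` and the values of `κ̃` -/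

section Values

variable (σ Fr : G) (n : ℕ) (H I : Subgroup G) (w_q w_1 : G → 𝒯) (c_q c_1 : G → 𝒯)

/-- At an `E`-split prime every summand of `𝒩w_q(Fr)` is `w_q(σ^j) + c_q(Fr)`: by the tame relation
`σ^{-j}Frσ^j = τ_j·Fr` with `τ_j ∈ ℐ ∩ H`, `c_q(τ_j) = 0`, `ρ(τ_j) = 1`, and `ρ(σ) = 1`. [folklore] -/
theorem norm_summand_at_Fr (hwq : ∀ h ∈ H, ∀ x : G, w_q (x * h) = w_q x + ρ x (c_q h))
    (hFr : Fr ∈ H) (hρσ : ρ σ = 1)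
    (htame : ∀ j : ℕ, ∃ τ : G, τ ∈ I ∧ τ ∈ H ∧ (σ ^ j)⁻¹ * Fr * σ ^ j = τ * Fr)
    (hcqI : ∀ τ : G, τ ∈ I → τ ∈ H → c_q τ = 0) (hρI : ∀ τ ∈ I, ρ τ = 1) (j : ℕ) :
    w_q (Fr * σ ^ j) = w_q (1 * σ ^ j) + c_q Fr := by
  obtain ⟨τ, hτI, hτH, hτ⟩ := htame j
  have hmem : (σ ^ j)⁻¹ * Fr * σ ^ j ∈ H := by rw [hτ]; exact H.mul_mem hτH hFr
  have hx : Fr * σ ^ j = 1 * σ ^ j * ((σ ^ j)⁻¹ * Fr * σ ^ j) := by group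
  have hρj : ρ (1 * σ ^ j) = 1 := by rw [one_mul, map_pow, hρσ, one_pow]
  rw [hx, hwq _ hmem, hρj, Module.End.one_apply, hτ,
    cocycle_mul_left_of_vanish ρ H w_q c_q hwq hτH hFr (hcqI τ hτI hτH) (hρI τ hτI)]

/-- **THE KEY FORMULA over `Ω` (MU-TRANSFER-PROOF §3, (3.1) at `h = Fr`): `t_N = −u_P·(g−1)·c_1(Fr)`,
i.e. `κ̃(σ) = −t_N = U'·T^e·t_1` with `t_1 = c_1(Fr)`, `g − 1 = T^e·(unit)`.** Inputs: the normalised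
norm relation `𝒩w_q = P·w_1 + ι(t_N)` evaluated at `x = Fr` and `x = 1`; the cocycle relations of
`w_q` (on `H ∋ Fr`) and `w_1`; the tame relation (so the `Fr`-side differs from the `1`-side by
`n·t_q = 0`); `ρ(Fr) = g` a scalar, `P = u_P(g−1)²`, and `g − 1` injective on `𝒯`. Over `Λ/p` the
correction term of the `ℤ/M`-version (KOLY-MEMO Prop. 5.5.A) is absent because `n ≡ 0`. [folklore] -/
theorem tN_eq (hn : (n : Ω) = 0) (P u_P g : Ω) (t_N : 𝒯)
    (hnorm : ∀ x : G, ∑ j ∈ range n, w_q (x * σ ^ j) = P • w_1 x + ρ x t_N)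
    (hwq : ∀ h ∈ H, ∀ x : G, w_q (x * h) = w_q x + ρ x (c_q h))
    (hw1 : ∀ y x : G, w_1 (x * y) = w_1 x + ρ x (c_1 y))
    (hFr : Fr ∈ H) (hρσ : ρ σ = 1)
    (htame : ∀ j : ℕ, ∃ τ : G, τ ∈ I ∧ τ ∈ H ∧ (σ ^ j)⁻¹ * Fr * σ ^ j = τ * Fr)
    (hcqI : ∀ τ : G, τ ∈ I → τ ∈ H → c_q τ = 0) (hρI : ∀ τ ∈ I, ρ τ = 1)
    (hg : ∀ t : 𝒯, ρ Fr t = g • t) (hP : P = u_P * (g - 1) ^ 2)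
    (hinj : ∀ t : 𝒯, (g - 1) • t = 0 → t = 0) :
    t_N = -((u_P * (g - 1)) • c_1 Fr) := by
  -- `𝒩w_q(Fr) = 𝒩w_q(1) + n·t_q = 𝒩w_q(1)`
  have hsumFr : ∑ j ∈ range n, w_q (Fr * σ ^ j) = ∑ j ∈ range n, w_q (1 * σ ^ j) := by
    rw [sum_congr rfl fun j _ =>
      norm_summand_at_Fr ρ σ Fr H I w_q c_q hwq hFr hρσ htame hcqI hρI j, sum_add_distrib,
      sum_const, card_range, ← Nat.cast_smul_eq_nsmul Ω, hn, zero_smul, add_zero]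
  -- compare the two evaluations of the norm relation
  have hFr' := hnorm Fr
  have h1 := hnorm 1
  rw [hsumFr, h1, map_one, Module.End.one_apply, hg,
    show w_1 Fr = w_1 1 + ρ 1 (c_1 Fr) by rw [← hw1 Fr 1, one_mul], map_one,
    Module.End.one_apply, smul_add] at hFr'
  -- `hFr' : P • w_1 1 + t_N = P • w_1 1 + P • c_1 Fr + g • t_N`
  have hkey : (g - 1) • t_N = -(P • c_1 Fr) := by
    rw [sub_smul, one_smul]
    have h' : t_N = P • c_1 Fr + g • t_N := add_left_cancel (hFr'.trans (add_assoc _ _ _))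
    calc g • t_N - t_N = g • t_N - (P • c_1 Fr + g • t_N) := by rw [← h']
      _ = -(P • c_1 Fr) := by abel
  have hzero : (g - 1) • (t_N + (u_P * (g - 1)) • c_1 Fr) = 0 := by
    rw [smul_add, hkey, hP, smul_smul, show (g - 1) * (u_P * (g - 1)) = u_P * (g - 1) ^ 2 by ring,
      neg_add_cancel]
  exact eq_neg_of_add_eq_zero_left (hinj _ hzero)

/-- **VALUE at `Fr` (transversality, part 1): `κ̃(Fr) = Σ_j j·c_q(σ^{-j}Frσ^j) = C(n,2)·t_q = 0`**, since
every `c_q(σ^{-j}Frσ^j) = c_q(Fr)` and `C(n,2) = Σ_{j<n} j ≡ 0` in `Ω` (`p` odd, `p ∣ n`). [folklore] -/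
theorem value_Fr (hC : ∑ j ∈ range n, (j : Ω) = 0)
    (hwq : ∀ h ∈ H, ∀ x : G, w_q (x * h) = w_q x + ρ x (c_q h)) (hFr : Fr ∈ H)
    (htame : ∀ j : ℕ, ∃ τ : G, τ ∈ I ∧ τ ∈ H ∧ (σ ^ j)⁻¹ * Fr * σ ^ j = τ * Fr)
    (hcqI : ∀ τ : G, τ ∈ I → τ ∈ H → c_q τ = 0) (hρI : ∀ τ ∈ I, ρ τ = 1) :
    ∑ j ∈ range n, (j : Ω) • c_q ((σ ^ j)⁻¹ * Fr * σ ^ j) = 0 := by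
  have hterm : ∀ j : ℕ, c_q ((σ ^ j)⁻¹ * Fr * σ ^ j) = c_q Fr := by
    intro j
    obtain ⟨τ, hτI, hτH, hτ⟩ := htame j
    rw [hτ, cocycle_mul_left_of_vanish ρ H w_q c_q hwq hτH hFr (hcqI τ hτI hτH) (hρI τ hτI)]
  simp_rw [hterm]
  rw [← sum_smul, hC, zero_smul]

/-- **VALUE on the inertia (transversality, part 2): `κ̃(τ) = 0` for `τ ∈ ℐ ∩ H`**: each conjugate
`σ^{-j}τσ^j` lies in `ℐ ∩ H` (`σ ∈ ℐ`, `H` normal), where `c_q` vanishes. [folklore] -/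
theorem value_inertia [H.Normal] (hσI : σ ∈ I) (hcqI : ∀ τ : G, τ ∈ I → τ ∈ H → c_q τ = 0) {τ : G}
    (hτI : τ ∈ I) (hτH : τ ∈ H) :
    ∑ j ∈ range n, (j : Ω) • c_q ((σ ^ j)⁻¹ * τ * σ ^ j) = 0 := by
  refine sum_eq_zero fun j _ => ?_
  have hI : (σ ^ j)⁻¹ * τ * σ ^ j ∈ I :=
    I.mul_mem (I.mul_mem (I.inv_mem (I.pow_mem hσI j)) hτI) (I.pow_mem hσI j)
  have hH : (σ ^ j)⁻¹ * τ * σ ^ j ∈ H := by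
    have := (inferInstance : H.Normal).conj_mem τ hτH (σ ^ j)⁻¹
    simpa using this
  rw [hcqI _ hI hH, smul_zero]

end Values

/-! ### §4 (appended) MU-TRANSFER-PROOF §2 LEMMA 1 (i): cocycles of the decomposition group vanish on the tame inertia -/

/-- **MU-TRANSFER-PROOF §2, Lemma 1 (i), kernel-checked at cochain level.** Let `𝒟` be a group (the
decomposition group at an `E`-split prime `q`), `c` a `1`-cocycle of `𝒟` with values in the
`Ω[𝒟]`-module `𝒯`, `Fr ∈ 𝒟` acting as a scalar `g` with `g − 1` injective on `𝒯` (`φ̃ − 1 = T^{e}·`unit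
on the free `Ω`-module `𝒯`), `τ ∈ 𝒟` acting trivially (`ρ(ℐ) = 1`), `w ∈ 𝒟` killed by `c` (wild
inertia: pro-`q` into a `p`-group) and the tame relation `Fr·τ·Fr⁻¹ = τ^q·w` with `q ≡ 1` in `Ω`
(`q ≡ 1 (mod p)`). Then `c(τ) = 0`: "`(φ̃ − q)c(τ) = (φ̃ − 1)c(τ) = 0`". Hence (memo)
`H¹(ℚ_q, 𝒯) = H¹(𝒟/ℐ, 𝒯) = 𝒯/(φ̃ − 1)𝒯`, the input `c_1|_ℐ = 0`, `c_q|_{ℐ∩H} = 0` of §3 above.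
[folklore] -/
theorem cocycle_vanish_on_inertia (D : Subgroup G) (c : G → 𝒯)
    (hc : ∀ a ∈ D, ∀ b ∈ D, c (a * b) = c a + ρ a (c b))
    (Fr : G) (hFr : Fr ∈ D) (g : Ω) (hg : ∀ t : 𝒯, ρ Fr t = g • t)
    (hinj : ∀ t : 𝒯, (g - 1) • t = 0 → t = 0)
    (q : ℕ) (hq : (q : Ω) = 1)
    {τ : G} (hτ : τ ∈ D) (hρτ : ρ τ = 1)
    (w : G) (hw : w ∈ D) (hcw : c w = 0)
    (htame : Fr * τ * Fr⁻¹ = τ ^ q * w) : c τ = 0 := by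
  -- on the powers of the trivially-acting `τ`, `c` is additive
  have hpow : ∀ m : ℕ, c (τ ^ m) = (m : Ω) • c τ := by
    intro m
    induction m with
    | zero =>
      have h := hc 1 D.one_mem 1 D.one_mem
      rw [one_mul, map_one, Module.End.one_apply] at h
      have h0 : c 1 = 0 := by simpa using h
      simp [h0]
    | succ m ih =>
      rw [pow_succ, hc _ (D.pow_mem hτ m) _ hτ, ih, map_pow, hρτ, one_pow, Module.End.one_apply,
        Nat.cast_succ, add_smul, one_smul]
  -- `c(Fr τ Fr⁻¹) = g • c(τ)`
  have hinv : c Fr + ρ Fr (c Fr⁻¹) = 0 := by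
    have h := hc Fr hFr Fr⁻¹ (D.inv_mem hFr)
    rw [mul_inv_cancel] at h
    have h1 := hc 1 D.one_mem 1 D.one_mem
    rw [one_mul, map_one, Module.End.one_apply] at h1
    have h0 : c 1 = 0 := by simpa using h1
    rw [h0] at h
    exact h.symm
  have hconj : c (Fr * τ * Fr⁻¹) = g • c τ := by
    rw [hc _ (D.mul_mem hFr hτ) _ (D.inv_mem hFr), hc _ hFr _ hτ, map_mul, hρτ, mul_one,
      add_assoc, ← map_add (ρ Fr), add_comm (c τ), map_add, ← add_assoc, hinv, zero_add, hg]
  -- `c(τ^q w) = q • c τ = c τ`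
  have hrhs : c (τ ^ q * w) = c τ := by
    rw [hc _ (D.pow_mem hτ q) _ hw, hcw, map_zero, add_zero, hpow, hq, one_smul]
  rw [htame, hrhs] at hconj
  have : (g - 1) • c τ = 0 := by rw [sub_smul, one_smul, ← hconj, sub_self]
  exact hinj _ this

/-! ### §5 (appended) MU-TRANSFER-PROOF §3 "COCHAINS": normalising the norm relation -/

/-- **The normalisation `𝒩w_q = P·w_1 + ι(t_N)` (MU-TRANSFER-PROOF §3, COCHAINS paragraph).** In the
induced-module model, Kato's norm relation `cor_{K/ℚ} 𝐳̄_q = P·𝐳̄_1` reads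
`𝒩w_q − P·w_1 ∈ ι𝒯 + 𝕎^G`, and `𝕎^G` (for `(g·w)(x) = w(xg)`) consists of the CONSTANT functions; so
`𝒩w_q = P·w_1 + ι(t) + m`. "Adding a coset function to `w_q` (same class)": subtracting `m·𝟙_H` — a
function invariant under right translation by `H`, hence with the same `H`-cocycle `c_q` — removes the
constant, because each `x` has exactly one `j < n` with `xσ^j ∈ H` (`G = ⊔ σ^i H`). Output: a
representative `w_q'` of the same class with `𝒩w_q' = P·w_1 + ι(t)`, the hypothesis `hnorm` of
`descent_sigma` / `tN_eq`. [folklore] -/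
theorem exists_normalised_repr (σ : G) (n : ℕ) (H : Subgroup G) (w_q w_1 : G → 𝒯) (c_q : G → 𝒯)
    (P : Ω) (t m : 𝒯)
    (hwq : ∀ h ∈ H, ∀ x : G, w_q (x * h) = w_q x + ρ x (c_q h))
    (hnorm : ∀ x : G, ∑ j ∈ range n, w_q (x * σ ^ j) = P • w_1 x + ρ x t + m)
    (hcoset : ∀ x : G, ∃! j : ℕ, j < n ∧ x * σ ^ j ∈ H) :
    ∃ w_q' : G → 𝒯, (∀ h ∈ H, ∀ x : G, w_q' (x * h) = w_q' x + ρ x (c_q h)) ∧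
      ∀ x : G, ∑ j ∈ range n, w_q' (x * σ ^ j) = P • w_1 x + ρ x t := by
  classical
  -- subtract the right-`H`-invariant function `m · 𝟙_H`
  refine ⟨fun x => w_q x - if x ∈ H then m else 0, fun h hh x => ?_, fun x => ?_⟩
  · have hiff : (x * h ∈ H) ↔ (x ∈ H) := by
      constructor
      · intro hxh; simpa using H.mul_mem hxh (H.inv_mem hh)
      · intro hx; exact H.mul_mem hx hh
    simp only [hiff, hwq h hh x]
    abel
  · rw [sum_sub_distrib, hnorm x]
    -- exactly one `j < n` has `x σ^j ∈ H`
    obtain ⟨j₀, ⟨hj₀n, hj₀H⟩, huniq⟩ := hcoset x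
    have hsum : ∑ j ∈ range n, (if x * σ ^ j ∈ H then m else 0) = m := by
      rw [← sum_filter, Finset.sum_const]
      have : (range n).filter (fun j => x * σ ^ j ∈ H) = {j₀} := by
        ext j
        simp only [mem_filter, mem_range, mem_singleton]
        constructor
        · rintro ⟨hjn, hjH⟩; exact huniq j ⟨hjn, hjH⟩
        · rintro rfl; exact ⟨hj₀n, hj₀H⟩
      rw [this, card_singleton, one_smul]
    rw [hsum]
    abel

end Summit.BirchSwinnertonDyer.BirchSwinnertonDyer.Rank1Residual.KolyvaginClass
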